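import Literature.NumberTheory.LFunctions.WeilOddGroundState
import Literature.NumberTheory.LFunctions.WeilGroundEnergyParitySplit
import HarnessLib

/-!
# Stub C of line `SketchIdeator5` (crux `OddSector.OddOneSignedWindows`): the strength certificate

`stub_tightBlockNonneg`: with the card's predicates inlined as a `let`-tower (sinc eigenfunctions,
seeds, odd prolate vectors, odd window tests `IsTest`, closed-energy lower bounds `IsELB`, and the
RH-strength block statement `Tight`), `Tight θ Δ K a` with `θ > 0` forces
`0 ≤ weilOddGroundEnergy a`.

Proof (RH-free, elementary). For `a ≤ 0` the odd ground energy is the junk value `0`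
(`weilOddGroundEnergy_of_nonpos`). For `a > 0` the number `R := ε := weilOddGroundEnergy a` is an
admissible lower bound for EVERY unit vector of the block's span, because every approximating odd
unit window test `gₙ` already has `ε ≤ Re Q(gₙ)` (`weilOddGroundEnergy_le`), so `ε - δ ≤ Re Q(gₙ)`
for all `n`. Clause (i) of `Tight` then gives `ε / (1 + θ e^{-4a}) ≤ Re Q(h)` for every odd unit
window test `h`, hence (taking the infimum over the nonempty odd sphere,
`le_weilOddGroundEnergy_of_forall`) `ε / (1 + θ e^{-4a}) ≤ ε`, which with `θ e^{-4a} > 0`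
forces `0 ≤ ε`.
-/

noncomputable section

set_option linter.dupNamespace false

open Complex Filter Set MeasureTheory
open scoped Real Topology

namespace Summit.RiemannHypothesis.RiemannHypothesis.Theorems.OddSector

open Literature.NumberTheory.LFunctions

/-- The elementary real-number core of the certificate: if `ε / (1 + q) ≤ ε` with `q > 0` then
`0 ≤ ε`. [folklore] -/
theorem nonneg_of_div_one_add_le_self {ε q : ℝ} (hq : 0 < q) (h : ε / (1 + q) ≤ ε) : 0 ≤ ε := by
  have h1 : (0 : ℝ) < 1 + q := by linarith
  rw [div_le_iff₀ h1] at h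
  nlinarith

/-- **Stub C — the strength certificate of K1 (RH-free, elementary).** With the card's predicates
inlined (`IsSincEigen c k ψ μ`: even continuous `L²([-1,1])`-normalised sinc-kernel eigenfunction
with exactly `k` zeros in `(0,1)`; seeds `φ = ψ ψ₁(0) − ψ₁ ψ(0)` rescaled to `[-e^a, e^a]`; odd
prolate vectors and blocks; `IsELB a w R`: `R` is a lower bound of the closed odd Weil energy of `w`):
if `Tight θ Δ K a` holds with `θ > 0` then `0 ≤ weilOddGroundEnergy a`. Reason: `R := ε_od(a)` is
admissible for EVERY `w` (each approximating odd unit test has `Re Q ≥ ε_od(a)`), so clause (i) gives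
`ε_od(a)/(1 + θe^{-4a}) ≤ Re Q(h)` on the odd unit sphere, i.e. `≤ ε_od(a)`; for `a ≤ 0` the junk
value `ε_od(a) = 0` also satisfies the conclusion. -/
theorem stub_tightBlockNonneg :
    let IsSincEigen : ℝ → ℕ → (ℝ → ℝ) → ℝ → Prop := fun c k ψ μ =>
      ContinuousOn ψ (Icc (-1) 1) ∧ (∀ x, ψ (-x) = ψ x) ∧ (∫ x in Icc (-1 : ℝ) 1, ψ x ^ 2 = 1) ∧
        (∀ x ∈ Icc (-1 : ℝ) 1, ∫ y in Icc (-1 : ℝ) 1,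
          (if x = y then c / Real.pi else Real.sin (c * (x - y)) / (Real.pi * (x - y))) * ψ y =
            μ * ψ x) ∧
        {x : ℝ | x ∈ Ioo (0 : ℝ) 1 ∧ ψ x = 0}.ncard = k ∧ {x : ℝ | x ∈ Ioo (0 : ℝ) 1 ∧ ψ x = 0}.Finite
    let IsSeed : ℝ → ℕ → (ℝ → ℝ) → Prop := fun lam m φ =>
      ∃ (ψ₁ ψ : ℝ → ℝ) (μ₁ μ : ℝ), IsSincEigen (2 * Real.pi * lam ^ 2) 1 ψ₁ μ₁ ∧
        IsSincEigen (2 * Real.pi * lam ^ 2) (2 * m + 1) ψ μ ∧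
        ∀ y, φ y = if |y| ≤ lam then ψ (y / lam) * ψ₁ 0 - ψ₁ (y / lam) * ψ 0 else 0
    let IsVec : ℝ → ℕ → (ℝ → ℂ) → Prop := fun a m v =>
      ∃ (φ : ℝ → ℝ) (N : ℝ), IsSeed (Real.exp a) m φ ∧ 0 < N ∧
        (∀ t, v t = if |t| ≤ a then
          (((N / 2) * (Real.exp (t / 2) * ∑' n : ℕ, φ ((n + 1 : ℕ) * Real.exp t) -
            Real.exp (-t / 2) * ∑' n : ℕ, φ ((n + 1 : ℕ) * Real.exp (-t))) : ℝ) : ℂ) else 0) ∧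
        ∫ t, ‖v t‖ ^ 2 = (1 : ℝ)
    let IsTest : ℝ → (ℝ → ℂ) → Prop := fun a h =>
      IsWeilTest h ∧ tsupport h ⊆ Icc (-a) a ∧ (∀ t, h (-t) = -h t) ∧ ∫ t, ‖h t‖ ^ 2 = (1 : ℝ)
    let IsELB : ℝ → (ℝ → ℂ) → ℝ → Prop := fun a w R =>
      ∀ g : ℕ → ℝ → ℂ, (∀ n, IsTest a (g n)) →
        Tendsto (fun n => ∫ t, ‖g n t - w t‖ ^ 2) atTop (𝓝 0) →
          ∀ δ : ℝ, 0 < δ → ∀ᶠ n in atTop, R - δ ≤ (weilQuadratic (g n)).re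
    let Tight : ℝ → ℝ → ℕ → ℝ → Prop := fun θ Δ K a =>
      ∃ v : Fin K → ℝ → ℂ, (∀ i : Fin K, IsVec a ((i : ℕ) + 1) (v i)) ∧
        ∀ R : ℝ, (∀ c : Fin K → ℂ, (∫ t, ‖∑ i, c i * v i t‖ ^ 2 = (1 : ℝ)) →
            IsELB a (fun t => ∑ i, c i * v i t) R) →
          (∀ h : ℝ → ℂ, IsTest a h → R / (1 + θ * Real.exp (-4 * a)) ≤ (weilQuadratic h).re) ∧
          (∀ h : ℝ → ℂ, IsTest a h → (∀ i, ∫ t, (starRingEnd ℂ) (v i t) * h t = 0) →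
            (1 + Δ) * weilOddGroundEnergy a ≤ (weilQuadratic h).re)
    ∀ (θ Δ : ℝ) (K : ℕ) (a : ℝ), 0 < θ → Tight θ Δ K a → 0 ≤ weilOddGroundEnergy a := by
  intro _ _ _ IsTest IsELB Tight θ Δ K a hθ hT
  -- the degenerate window: junk value `0`
  rcases le_or_gt a 0 with ha | ha
  · exact (weilOddGroundEnergy_of_nonpos ha).ge
  -- `a > 0`: `R := ε_od(a)` is admissible for every unit vector of the block's span
  obtain ⟨v, -, hR⟩ := hT
  set ε : ℝ := weilOddGroundEnergy a with hε
  have hadm : ∀ c : Fin K → ℂ, (∫ t, ‖∑ i, c i * v i t‖ ^ 2 = (1 : ℝ)) →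
      IsELB a (fun t => ∑ i, c i * v i t) ε := by
    intro c _ g hg _ δ hδ
    exact Eventually.of_forall fun n ↦ by
      have hle : ε ≤ (weilQuadratic (g n)).re :=
        weilOddGroundEnergy_le (hg n).1 (hg n).2.1 (hg n).2.2.1 (hg n).2.2.2
      linarith
  -- clause (i): `ε / (1 + θ e^{-4a}) ≤ Re Q(h)` on the odd unit sphere, hence `≤ ε`
  have h1 : ∀ h : ℝ → ℂ, IsTest a h → ε / (1 + θ * Real.exp (-4 * a)) ≤ (weilQuadratic h).re :=
    (hR ε hadm).1
  have h2 : ε / (1 + θ * Real.exp (-4 * a)) ≤ ε :=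
    le_weilOddGroundEnergy_of_forall ha fun h hh hs ho hn ↦ h1 h ⟨hh, hs, ho, hn⟩
  exact nonneg_of_div_one_add_le_self (mul_pos hθ (Real.exp_pos _)) h2

/-- **Curried corollary of `stub_tightBlockNonneg`** (the form used downstream, free of the
`let`-tower): if for some `θ > 0` every normalised smooth odd window test `h` on `[-a, a]` has
`weilOddGroundEnergy a / (1 + θ e^{-4a}) ≤ Re Q(h)`, then `0 ≤ weilOddGroundEnergy a`. [folklore] -/
theorem weilOddGroundEnergy_nonneg_of_forall_div_le {a θ : ℝ} (hθ : 0 < θ)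
    (h1 : ∀ h : ℝ → ℂ, IsWeilTest h → tsupport h ⊆ Icc (-a) a → (∀ t, h (-t) = -h t) →
      ∫ t, ‖h t‖ ^ 2 = (1 : ℝ) →
        weilOddGroundEnergy a / (1 + θ * Real.exp (-4 * a)) ≤ (weilQuadratic h).re) :
    0 ≤ weilOddGroundEnergy a := by
  rcases le_or_gt a 0 with ha | ha
  · exact (weilOddGroundEnergy_of_nonpos ha).ge
  exact nonneg_of_div_one_add_le_self (mul_pos hθ (Real.exp_pos _))
    (le_weilOddGroundEnergy_of_forall ha h1)

end Summit.RiemannHypothesis.RiemannHypothesis.Theorems.OddSector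

end
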